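import Literature.MathematicalPhysics.QuantumFieldTheory.Balaban1983to89.B15BasicStep
import Literature.MathematicalPhysics.QuantumFieldTheory.Balaban1983to89.B15RopTotal

/-!
# `Balaban1983to89.B15FibreLemmaSupp` — T. Bałaban, *Large field renormalization. I. The basic step of the ℝ
operation*, Commun. Math. Phys. **122** (1989) 175–202 [Balaban1989LargeFieldI], (0.3)–(0.4) p. 176 and (1.102)
p. 201: THE FIBRE LEMMA CHAIN IN SUPPORT FORM (append-only successor of `B15BasicStep` §Fibre ∕ §SetupBridge and
`B15RopTotal` §1; no landed declaration is touched — successor names `_supp` ∕ `Supp`)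

statement-level skeleton of published theorems with citation tags; proofs where landed; nothing here is a claim about
the Yang–Mills mass gap

CITATION HEADER (verbatim, p. 176 [PDF 2]): (0.3) *"(ℝρ)(V) = Σ_Z ρ(Z″, V) ∫dV⌈_{Z′}ρ(Z, V) / ∫dV⌈_{Z′}ρ(Z″, V)"*;
*"the densities are positive, and the integration domains in the integrals above are nonempty, hence the denominators
are positive"*; (0.4) *"It satisfies the basic normalization property ∫dV(𝐑ρ)(V) = ∫dVρ(V)."*; p. 201 (1.102).

WHY THIS FILE (cell `pub-ymgap`, HUMAN RULING D-0062 Track A; NODE 00 object ₇ — definer `node00-def-R`'s CUT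
[NODE00-DEF-R-G0-CUT-FOR-N10B], caveat (R-C1), typed by seat `pub-ymgap-dag-n10-b`).  b01's PROVED (0.4) chain
`lmarginal_ratio_term → integral_normTerm_eq → integral_ropReal_eq` (consumed by `B15RopTotal.RepData.Provisos`, last
conjunct `∀ Z V, fibreIntegral (fib Z) (piece (pp Z)) V ≠ 0`) asks the denominator fibre integral `∫dV′⌈_{Z′}ρ(Z″, V′, V)`
to be nonzero at EVERY base point `V`; for genuine (2.18) pieces `ρ(Z″, ·) = χ(s″)·(𝐓e^A)(s″)` with INDICATOR
characteristic functions this fails at base points outside the support of the constraints off `Z′` (there `ρ(Z″, ·) ≡ 0`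
along the whole fibre — harmless in print, `0·(0/0)`, but it makes `Provisos` false, hence the totalised operator the
identity branch on such data).  Print's proviso is about the SUPPORT.  THIS FILE weakens the hypothesis to the support
form `∫⌈den = 0 ⇒ ∫⌈num = 0` (resp. `fibreIntegral s new V = 0 ⇒ old V = 0`, pointwise in `V`), with the SAME
conclusions: `lmarginal_ratio_term_supp` (the `ℝ≥0∞` ratio identity: where the denominator fibre integral vanishes so
does the numerator's, and `0·(0/0) = 0`), `integral_normTerm_eq_supp` ∕ `integrable_normTerm_supp` (the fibre integral
of `new` is fibre-constant — `indepOf_lmarginal` — so its vanishing at `V` kills `old` on the whole fibre through `V`),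
`integral_ropReal_eq_supp` ((0.4) over `Setup`), and in `namespace B15RopTotal`: `RepData.ProvisosSupp`,
`RepData.provisosSupp_of_provisos`, `RepData.integral_rop_eq_of_provisosSupp` ((0.4) for the datum under the support-form
provisos).  The v1.2 pin over `AdmissibleSupp` is the definer's successor, not this file.
HONEST SCOPE.  One located measure-theory lemma chain weakening a typed proviso toward print's; nothing of Bałaban's
asserted; no estimate; counts unmoved; one finite torus; not continuum ∕ ℝ⁴ ∕ OS ∕ mass-gap ∕ Clay.  No `sorry`, no
instance, no notation.
-/

open scoped BigOperators ENNReal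
open _root_.MeasureTheory Function Finset

noncomputable section

namespace Literature.MathematicalPhysics.QuantumFieldTheory.Balaban1983to89.B15.BasicStep

/-! ## §1. The ratio identity in support form (`ℝ≥0∞`, Mathlib `lmarginal`) -/

section Fibre

variable {ι : Type*} [DecidableEq ι] {X : ι → Type*} [∀ i, MeasurableSpace (X i)]
  {μ : ∀ i, Measure (X i)}

/-- **THE RATIO IDENTITY behind (0.3)∕(0.4), SUPPORT FORM** — p. 176 [PDF 2] *"the densities are positive, and the
integration domains in the integrals above are nonempty, hence the denominators are positive"* read on the SUPPORT: for a
measurable `den` with finite fibre integrals, if the fibre integral of `num` vanishes wherever that of `den` does, then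
`den · (∫⌈num)/(∫⌈den)` has the same fibre integral as `num` (where `∫⌈den = 0` both sides vanish: `0·(0/0) = 0` in
`ℝ≥0∞`).  Successor of `lmarginal_ratio_term` (hypothesis `∫⌈den ≠ 0` everywhere). [cite: Balaban1989LargeFieldI, (0.3)–(0.4) p.176] -/
theorem lmarginal_ratio_term_supp (s : Finset ι) {num den : (∀ i, X i) → ℝ≥0∞} (hden : Measurable den)
    (htop : ∀ x, (∫⋯∫⁻_s, den ∂μ) x ≠ ∞)
    (hsupp : ∀ x, (∫⋯∫⁻_s, den ∂μ) x = 0 → (∫⋯∫⁻_s, num ∂μ) x = 0) :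
    ∫⋯∫⁻_s, (fun V => den V * ((∫⋯∫⁻_s, num ∂μ) V / (∫⋯∫⁻_s, den ∂μ) V)) ∂μ = ∫⋯∫⁻_s, num ∂μ := by
  have hratio : IndepOf s (fun V => (∫⋯∫⁻_s, num ∂μ) V / (∫⋯∫⁻_s, den ∂μ) V) := by
    intro x y
    simp only [indepOf_lmarginal μ s num x y, indepOf_lmarginal μ s den x y]
  have hrw : (fun V => den V * ((∫⋯∫⁻_s, num ∂μ) V / (∫⋯∫⁻_s, den ∂μ) V))
      = (fun V => (∫⋯∫⁻_s, num ∂μ) V / (∫⋯∫⁻_s, den ∂μ) V) * den := by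
    ext V; simp [mul_comm]
  rw [hrw, lmarginal_mul_of_indepOf s hratio hden]
  ext x
  simp only [Pi.mul_apply]
  by_cases hx : (∫⋯∫⁻_s, den ∂μ) x = 0
  · rw [hx, hsupp x hx, ENNReal.zero_div, zero_mul]
  · exact ENNReal.div_mul_cancel hx (htop x)

end Fibre

/-! ## §2. Over `Setup`: the normalized term and (0.4) in support form -/

section SetupBridge

variable {P : Params} {j : ℕ} {G : Type*} [GaugeGroup G] [MeasurableSpace G] [HaarData G]
variable [DecidableEq (PBond P j)]

/-- The fibre integral of a density is constant along the fibre (`indepOf_lmarginal`, real reading). [cite: Balaban1989LargeFieldI, (0.3) p.176 (bookkeeping)] -/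
theorem fibreIntegral_updateFinset (s : Finset (PBond P j)) (f : Density P j G) (V : GaugeField P j G)
    (y : ∀ _ : s, G) : fibreIntegral s f (updateFinset V s y) = fibreIntegral s f V := by
  simp only [fibreIntegral]
  rw [indepOf_lmarginal (fun _ : PBond P j => (HaarData.haar : Measure G)) s _ V y]

/-- SUPPORT MECHANISM: if the (real) fibre integral of a non-negative bounded measurable `new` vanishes at `V` and
`old` vanishes wherever that fibre integral does, then the `ℝ≥0∞` fibre integral of `old` vanishes at `V` (the fibre
integral is fibre-constant, so `old ≡ 0` on the whole fibre through `V`). [cite: Balaban1989LargeFieldI, (0.3) p.176 (bookkeeping)] -/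
theorem lmarginal_ofReal_eq_zero_of_supp (s : Finset (PBond P j)) {new old : Density P j G}
    (hsupp : ∀ V, fibreIntegral s new V = 0 → old V = 0) (V : GaugeField P j G) (hV : fibreIntegral s new V = 0) :
    (∫⋯∫⁻_s, (fun U => ENNReal.ofReal (old U)) ∂(fun _ : PBond P j => (HaarData.haar : Measure G))) V = 0 := by
  have hfib : ∀ y : ∀ _ : s, G, old (updateFinset V s y) = 0 := fun y =>
    hsupp _ (by rw [fibreIntegral_updateFinset]; exact hV)
  simp only [lmarginal, hfib, ENNReal.ofReal_zero, lintegral_zero]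

/-- **(1.102) for one renormalized component, SUPPORT FORM** — as `integral_normTerm_eq`, with the proviso
`∀ V, fibreIntegral s new V ≠ 0` replaced by the pointwise support condition `fibreIntegral s new V = 0 → old V = 0`:
`∫dV [new · ∫dV⌈old/∫dV⌈new] = ∫dV old` over `Setup.fieldMeasure` (where the denominator vanishes the fibre carries no
`old`-mass and the term is `0`). [cite: Balaban1989LargeFieldI, (1.102) p.201] -/
theorem integral_normTerm_eq_supp (s : Finset (PBond P j)) {new old : Density P j G}
    (hnew_m : Measurable new) (hold_m : Measurable old) (hnew0 : ∀ V, 0 ≤ new V) (hold0 : ∀ V, 0 ≤ old V)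
    {C : ℝ} (hnewC : ∀ V, new V ≤ C) (holdC : ∀ V, old V ≤ C)
    (hsupp : ∀ V, fibreIntegral s new V = 0 → old V = 0) :
    ∫ V, normTerm s new old V ∂(fieldMeasure P j G) = ∫ V, old V ∂(fieldMeasure P j G) := by
  set μH : PBond P j → Measure G := fun _ => (HaarData.haar : Measure G) with hμH
  set Ln := ∫⋯∫⁻_s, (fun U => ENNReal.ofReal (new U)) ∂μH with hLn
  set Lo := ∫⋯∫⁻_s, (fun U => ENNReal.ofReal (old U)) ∂μH with hLo
  have hLn_top : ∀ V, Ln V ≠ ∞ := fun V =>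
    ne_top_of_le_ne_top ENNReal.ofReal_ne_top (lmarginal_ofReal_le s hnewC V)
  have hLo_top : ∀ V, Lo V ≠ ∞ := fun V =>
    ne_top_of_le_ne_top ENNReal.ofReal_ne_top (lmarginal_ofReal_le s holdC V)
  -- the support mechanism: where `Ln` vanishes, so does `Lo`
  have hLo_zero : ∀ V, Ln V = 0 → Lo V = 0 := by
    intro V h
    have hfib : fibreIntegral s new V = 0 := by
      simp only [fibreIntegral]; rw [← hμH, ← hLn, h, ENNReal.toReal_zero]
    exact lmarginal_ofReal_eq_zero_of_supp s hsupp V hfib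
  have hLn_m : Measurable Ln := (ofReal_comp_measurable hnew_m).lmarginal μH
  have hLo_m : Measurable Lo := (ofReal_comp_measurable hold_m).lmarginal μH
  -- pointwise identification of `ofReal ∘ normTerm` with the `ℝ≥0∞` ratio term (both vanish where `Ln` does)
  have hpt : ∀ V, ENNReal.ofReal (normTerm s new old V) = ENNReal.ofReal (new V) * (Lo V / Ln V) := by
    intro V
    by_cases hV : Ln V = 0
    · have hLoV : Lo V = 0 := hLo_zero V hV
      simp only [normTerm, fibreIntegral]
      rw [← hμH, ← hLn, ← hLo, hV, hLoV, ENNReal.toReal_zero, zero_div, mul_zero, ENNReal.zero_div, mul_zero,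
        ENNReal.ofReal_zero]
    · have hr : Lo V / Ln V ≠ ∞ := (ENNReal.div_lt_top (hLo_top V) hV).ne
      simp only [normTerm, fibreIntegral]
      rw [← hμH, ← hLn, ← hLo, ← ENNReal.toReal_div, ENNReal.ofReal_mul (hnew0 V), ENNReal.ofReal_toReal hr]
  have hnt0 : ∀ V, 0 ≤ normTerm s new old V := fun V =>
    mul_nonneg (hnew0 V) (div_nonneg ENNReal.toReal_nonneg ENNReal.toReal_nonneg)
  have hnt_m : Measurable (normTerm s new old) := by
    have : Measurable (fun V => fibreIntegral s old V / fibreIntegral s new V) :=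
      (hLo_m.ennreal_toReal).div (hLn_m.ennreal_toReal)
    exact hnew_m.mul this
  -- the `ℝ≥0∞` integrals agree by the fibre mechanism in support form
  have hlint : ∫⁻ V, ENNReal.ofReal (normTerm s new old V) ∂(fieldMeasure P j G)
      = ∫⁻ V, ENNReal.ofReal (old V) ∂(fieldMeasure P j G) := by
    rw [fieldMeasure_eq_pi]
    simp_rw [hpt]
    exact lintegral_eq_of_lmarginal_eq s ((ofReal_comp_measurable hnew_m).mul (hLo_m.div hLn_m))
      (ofReal_comp_measurable hold_m)
      (lmarginal_ratio_term_supp s (ofReal_comp_measurable hnew_m) hLn_top hLo_zero)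
  rw [integral_eq_lintegral_of_nonneg_ae (Filter.Eventually.of_forall hnt0) hnt_m.aestronglyMeasurable,
    integral_eq_lintegral_of_nonneg_ae (Filter.Eventually.of_forall hold0) hold_m.aestronglyMeasurable, hlint]

/-- The normalized term is integrable under the support-form proviso (nonnegative with the finite integral of `old`);
successor of `integrable_normTerm`. [cite: Balaban1989LargeFieldI, (1.102) p.201 (bookkeeping)] -/
theorem integrable_normTerm_supp (s : Finset (PBond P j)) {new old : Density P j G}
    (hnew_m : Measurable new) (hold_m : Measurable old) (hnew0 : ∀ V, 0 ≤ new V)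
    {C : ℝ} (hnewC : ∀ V, new V ≤ C) (holdC : ∀ V, old V ≤ C)
    (hsupp : ∀ V, fibreIntegral s new V = 0 → old V = 0) :
    Integrable (normTerm s new old) (fieldMeasure P j G) := by
  set μH : PBond P j → Measure G := fun _ => (HaarData.haar : Measure G) with hμH
  set Ln := ∫⋯∫⁻_s, (fun U => ENNReal.ofReal (new U)) ∂μH with hLn
  set Lo := ∫⋯∫⁻_s, (fun U => ENNReal.ofReal (old U)) ∂μH with hLo
  have hLn_top : ∀ V, Ln V ≠ ∞ := fun V =>
    ne_top_of_le_ne_top ENNReal.ofReal_ne_top (lmarginal_ofReal_le s hnewC V)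
  have hLo_top : ∀ V, Lo V ≠ ∞ := fun V =>
    ne_top_of_le_ne_top ENNReal.ofReal_ne_top (lmarginal_ofReal_le s holdC V)
  have hLo_zero : ∀ V, Ln V = 0 → Lo V = 0 := by
    intro V h
    have hfib : fibreIntegral s new V = 0 := by
      simp only [fibreIntegral]; rw [← hμH, ← hLn, h, ENNReal.toReal_zero]
    exact lmarginal_ofReal_eq_zero_of_supp s hsupp V hfib
  have hLn_m : Measurable Ln := (ofReal_comp_measurable hnew_m).lmarginal μH
  have hLo_m : Measurable Lo := (ofReal_comp_measurable hold_m).lmarginal μH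
  have hpt : ∀ V, ENNReal.ofReal (normTerm s new old V) = ENNReal.ofReal (new V) * (Lo V / Ln V) := by
    intro V
    by_cases hV : Ln V = 0
    · have hLoV : Lo V = 0 := hLo_zero V hV
      simp only [normTerm, fibreIntegral]
      rw [← hμH, ← hLn, ← hLo, hV, hLoV, ENNReal.toReal_zero, zero_div, mul_zero, ENNReal.zero_div, mul_zero,
        ENNReal.ofReal_zero]
    · have hr : Lo V / Ln V ≠ ∞ := (ENNReal.div_lt_top (hLo_top V) hV).ne
      simp only [normTerm, fibreIntegral]
      rw [← hμH, ← hLn, ← hLo, ← ENNReal.toReal_div, ENNReal.ofReal_mul (hnew0 V), ENNReal.ofReal_toReal hr]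
  have hnt0 : ∀ V, 0 ≤ normTerm s new old V := fun V =>
    mul_nonneg (hnew0 V) (div_nonneg ENNReal.toReal_nonneg ENNReal.toReal_nonneg)
  have hnt_m : Measurable (normTerm s new old) := by
    have : Measurable (fun V => fibreIntegral s old V / fibreIntegral s new V) :=
      (hLo_m.ennreal_toReal).div (hLn_m.ennreal_toReal)
    exact hnew_m.mul this
  refine ⟨hnt_m.aestronglyMeasurable, ?_⟩
  rw [hasFiniteIntegral_iff_ofReal (Filter.Eventually.of_forall hnt0)]
  simp_rw [hpt]
  have hlint : ∫⁻ V, ENNReal.ofReal (new V) * (Lo V / Ln V) ∂(fieldMeasure P j G)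
      = ∫⁻ V, ENNReal.ofReal (old V) ∂(fieldMeasure P j G) :=
    lintegral_eq_of_lmarginal_eq s ((ofReal_comp_measurable hnew_m).mul (hLo_m.div hLn_m))
      (ofReal_comp_measurable hold_m)
      (lmarginal_ratio_term_supp s (ofReal_comp_measurable hnew_m) hLn_top hLo_zero)
  rw [hlint]
  calc ∫⁻ V, ENNReal.ofReal (old V) ∂(fieldMeasure P j G)
      ≤ ∫⁻ _V, ENNReal.ofReal C ∂(fieldMeasure P j G) :=
        lintegral_mono (fun V => ENNReal.ofReal_le_ofReal (holdC V))
    _ < ∞ := by simp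

/-- **(0.4) over `Setup`, SUPPORT FORM** — as `integral_ropReal_eq`, with the denominator proviso replaced by the support
condition `∀ Z V, fibreIntegral (fib Z) (piece (pp Z)) V = 0 → piece Z V = 0` (print p. 176: the denominators are
positive ON THE SUPPORT of the corresponding terms): `∫dV (ℝρ)(V) = ∫dV Σ_Z ρ(Z, V)`. [cite: Balaban1989LargeFieldI, (0.4) p.176] -/
theorem integral_ropReal_eq_supp {R : Type*} [Fintype R] (piece : R → Density P j G) (pp : R → R)
    (fib : R → Finset (PBond P j)) (hm : ∀ Z, Measurable (piece Z)) (h0 : ∀ Z V, 0 ≤ piece Z V)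
    {C : ℝ} (hC : ∀ Z V, piece Z V ≤ C)
    (hsupp : ∀ Z V, fibreIntegral (fib Z) (piece (pp Z)) V = 0 → piece Z V = 0) :
    ∫ V, RopReal piece pp fib V ∂(fieldMeasure P j G) = ∫ V, ∑ Z, piece Z V ∂(fieldMeasure P j G) := by
  simp only [RopReal]
  rw [integral_finsetSum _ (fun Z _ => integrable_normTerm_supp (fib Z) (hm (pp Z)) (hm Z) (h0 (pp Z))
      (hC (pp Z)) (hC Z) (hsupp Z)),
    integral_finsetSum _ (fun Z _ => ?_)]
  · exact Finset.sum_congr rfl (fun Z _ => integral_normTerm_eq_supp (fib Z) (hm (pp Z)) (hm Z) (h0 (pp Z)) (h0 Z)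
      (hC (pp Z)) (hC Z) (hsupp Z))
  · refine ⟨(hm Z).aestronglyMeasurable, ?_⟩
    rw [hasFiniteIntegral_iff_ofReal (Filter.Eventually.of_forall (h0 Z))]
    calc ∫⁻ V, ENNReal.ofReal (piece Z V) ∂(fieldMeasure P j G)
        ≤ ∫⁻ _V, ENNReal.ofReal C ∂(fieldMeasure P j G) :=
          lintegral_mono (fun V => ENNReal.ofReal_le_ofReal (hC Z V))
      _ < ∞ := by simp

end SetupBridge

end Literature.MathematicalPhysics.QuantumFieldTheory.Balaban1983to89.B15.BasicStep

/-! ## §3. The support-form provisos of the representation datum and (0.4) for the datum -/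

namespace Literature.MathematicalPhysics.QuantumFieldTheory.Balaban1983to89.B15RopTotal

open B15.BasicStep (fibreIntegral normTerm RopReal integral_ropReal_eq_supp)

variable {P : Params} {j : ℕ} {G : Type*} [GaugeGroup G] [MeasurableSpace G] [HaarData G]

namespace RepData

variable (d : RepData P j G)

/-- **The provisos of p. 176 IN SUPPORT FORM** for the datum: every piece measurable, non-negative and uniformly bounded,
and — in place of «every denominator fibre integral nowhere zero» — *«the denominators are positive»* ON THE SUPPORT:
wherever the fibre integral `∫dV⌈_{Z′}ρ(Z″, ·)` vanishes at `V`, the piece `ρ(Z, V)` vanishes too.  A `Prop` with body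
about the datum (no fact is named). [cite: Balaban1989LargeFieldI, (0.3) p.176] -/
def ProvisosSupp [DecidableEq (PBond P j)] : Prop :=
  (∀ Z, Measurable (d.piece Z)) ∧ (∀ Z V, 0 ≤ d.piece Z V) ∧ (∃ C : ℝ, ∀ Z V, d.piece Z V ≤ C) ∧
    ∀ Z V, fibreIntegral (d.fib Z) (d.piece (d.pp Z)) V = 0 → d.piece Z V = 0

/-- The provisos as typed by `Provisos` (denominators nowhere zero) imply the support form (its last conjunct is then
vacuous). [cite: Balaban1989LargeFieldI, (0.3) p.176 (bookkeeping)] -/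
theorem provisosSupp_of_provisos [DecidableEq (PBond P j)] (h : d.Provisos) : d.ProvisosSupp :=
  ⟨h.1, h.2.1, h.2.2.1, fun Z V h0 => absurd h0 (h.2.2.2 Z V)⟩

/-- **(0.4) FOR THE DATUM under the support-form provisos**: `∫dV (𝐑ρ)(V) = ∫dV ρ(V)` with `𝐑ρ = d.rop` ((0.3) of the
datum) and `ρ = d.total` ((0.2)) — `integral_ropReal_eq_supp` at the datum's own `Fintype` structure. [cite: Balaban1989LargeFieldI, (0.4) p.176] -/
theorem integral_rop_eq_of_provisosSupp [DecidableEq (PBond P j)] (h : d.ProvisosSupp) :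
    ∫ V, d.rop V ∂(fieldMeasure P j G) = ∫ V, d.total V ∂(fieldMeasure P j G) := by
  letI := d.fin
  obtain ⟨hm, h0, ⟨C, hC⟩, hsupp⟩ := h
  exact integral_ropReal_eq_supp d.piece d.pp d.fib hm h0 hC hsupp

end RepData

end Literature.MathematicalPhysics.QuantumFieldTheory.Balaban1983to89.B15RopTotal

end
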